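import Summits.CriticalPhenomena.PercolationContinuityZ3.Theses.PercNonProliferation
import Summits.CriticalPhenomena.PercolationContinuityZ3.Theorems.NonProliferation.Negative.AboveSix
import Summits.CriticalPhenomena.PercolationContinuityZ3.Theorems.PercNonProliferationNonProliferationStubInnerCellCount
import Literature.Probability.Percolation.UniquenessInfiniteCluster
import Literature.Probability.Percolation.KestenTheorem
import Literature.Probability.Percolation.SharpnessDCTProofs
import HarnessLib

/-!
# Crux `PercNonProliferation.NonProliferation` (stmt-CriticalPhenomena-4444), line `boundary-pinning` —
# the QUALITATIVE multi-crosser decay at FIXED inner scale (every `d`, every `p`)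

Lead's calibration file for the open bulk stub `stub_threeCrosserDecay` of the registered skeleton
`Cruxes/NonProliferation/Lines/boundary_pinning.lean` (prover-line-stmt-CriticalPhenomena-4444-c5).
Lands with `--supports stmt-CriticalPhenomena-4444`; closes nothing by itself.

The stub asks for an `m`-UNIFORM rate: `∀ η > 0, ∃ k ≥ 2, ∀ m ≥ m₀, k² · P_{p_c(ℤ³)}(three points of
B(m), each joined inside B(km) to ∂ⁱⁿB(km), pairwise not joined inside B(km)) ≤ η`. Here we prove what
IS available unconditionally, and record that it is exactly the non-uniform shadow of the stub:

* `multiCross_tendsto_zero_of_fixed_inner` — for EVERY dimension `d`, EVERY edge density `p`, every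
  multiplicity `r ≥ 1` and every FIXED inner radius `m`, the probability that `r+1` points of `B(m)` are
  each joined inside `B(L)` to `∂ⁱⁿB(L)` and pairwise not joined inside `B(L)` tends to `0` as `L → ∞`.
  Proof: the event is contained in the union over pairs `a, b ∈ B(m)` of the two-crosser events
  (`pair_tendsto_zero`); on lattice configurations these are antitone in `L` (first exit,
  `exists_mem_innerBoundary_openConnIn`), so by continuity from above their probabilities decrease to
  the probability that `a` and `b` lie in two distinct INFINITE open clusters, which is `0` by the
  uniqueness of the infinite cluster on `ℤ^d` at every `p` (Aizenman–Kesten–Newman / Burton–Keane,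
  in tree: `Grimmett1999_numInfiniteClusters_le_one_holds`).
* `threeCrossers_tendsto_zero_of_fixed_inner` — the stub's own indexing: for fixed `m ≥ 1`,
  `P_{p_c(ℤ³)}(three box-distinct crossers of B(km) ∖ B(m)) → 0` as `k → ∞`.

What this calibrates. The statement proved here is dimension-free and `p`-free, hence (by
`Negative.nonProliferation_false_without_dimThree`, i.e. Aizenman's `d > 6` proliferation) it can feed
no proof of the crux: above six dimensions the same qualitative decay holds while `k² · P → ∞` along
`m ≍ L/k`. The ENTIRE content of `stub_threeCrosserDecay` is therefore the uniformity of the rate in the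
inner scale `m` (an `o(k⁻²)` bound valid for all large `m` at once) — the hyperscaling-side input for
which no engine exists in print or in the tree (the in-tree quantitative two-cluster bounds,
`exists_real_edgeTwoArms_le` = Cerf 2015 Prop. 5.2 and `dkt_prop1`, pay for the inner scale
exponentially resp. restrict it to `m ≤ L^α`, which is the landed `PowerCap`).
-/

noncomputable section

namespace Summit.CriticalPhenomena.PercolationContinuityZ3.Theorems.NonProliferation

open MeasureTheory Filter Topology
open Literature.Probability.LatticeModels Literature.Probability.Percolation
open Summit.CriticalPhenomena.PercolationContinuityZ3.Theorems.NonProliferation.Negative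

namespace FixedInnerDecay

variable {d : ℕ}

/-! ### The limiting configuration: two distinct infinite clusters

(Lattice bookkeeping reused from `SharpnessDCTProofs.lean`: `DCT16.notMem_box_of_mem_innerBoundary_box`
— a site of `∂ⁱⁿB(n)` lies outside `B(m)` for `m < n` — and `DCT16.exists_subset_box` — a finite set of
sites lies in some box.)
-/

/-- A point joined inside `B(m+k)` to `∂ⁱⁿB(m+k)` for EVERY `k` has an infinite open cluster (its
cluster meets the boundary sphere of every large box, so it is not contained in any box). -/
theorem percolatesAt_of_forall {ω : BondConfig (Site d)} {a : Site d} {m : ℕ}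
    (h : ∀ k : ℕ, ∃ y ∈ innerBoundary (zdGraph d) (box d (m + k)),
      ω ∈ openConnIn (↑(box d (m + k)) : Set (Site d)) a y) :
    ω ∈ percolatesAt a := by
  change (openCluster ω a).Infinite
  intro hfin
  obtain ⟨R, hR⟩ := DCT16.exists_subset_box hfin.toFinset
  obtain ⟨y, hy, hay⟩ := h (R + 1)
  have hyC : y ∈ openCluster ω a := StubInnerCellCount.reachable_of_mem_openConnIn hay
  exact DCT16.notMem_box_of_mem_innerBoundary_box (by omega : R < m + (R + 1)) hy
    (hR (hfin.mem_toFinset.2 hyC))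

/-- Two points NOT joined inside `B(m+k)` for every `k` are not joined at all (an open path is finite,
hence lies inside some box). -/
theorem not_reachable_of_forall {ω : BondConfig (Site d)} {a b : Site d} {m : ℕ}
    (h : ∀ k : ℕ, ω ∉ openConnIn (↑(box d (m + k)) : Set (Site d)) a b) :
    ¬ (openGraph ω).Reachable a b := by
  classical
  rintro ⟨w⟩
  obtain ⟨R, hR⟩ := DCT16.exists_subset_box w.support.toFinset
  refine h R (mem_openConnIn_of_walk w (fun z hz => ?_) (fun e he => ?_))
  · exact Finset.mem_coe.2 (box_mono d (Nat.le_add_left R m) (hR (List.mem_toFinset.2 hz)))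
  · exact edgeSet_openGraph_subset ω (w.edges_subset_edgeSet he)

/-- **Uniqueness kills the limit.** For every `d`, `p` and sites `a`, `b`: the event that `a` and `b`
have infinite open clusters and are not joined has probability `0`
(`Grimmett1999_numInfiniteClusters_le_one_holds`, `numInfiniteClusters_le_one_iff`). -/
theorem measure_twoInfinite_eq_zero (d : ℕ) (p : unitInterval) (a b : Site d) :
    bondPercolation (zdGraph d) p
      {ω | ω ∈ percolatesAt a ∧ ω ∈ percolatesAt b ∧ ¬ (openGraph ω).Reachable a b} = 0 := by
  have hU := Grimmett1999_numInfiniteClusters_le_one_holds d p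
  rw [ae_iff] at hU
  refine measure_mono_null (fun ω hω => ?_) hU
  obtain ⟨ha, hb, hab⟩ := hω
  exact fun hle => hab ((numInfiniteClusters_le_one_iff ω).1 hle a b ha hb)

/-! ### The two-crosser event of a fixed pair: antitone in the outer scale, measurable -/

/-- **First exit.** On a lattice configuration, a point of `B(m) ⊆ B(L)` joined inside `B(L')` to
`∂ⁱⁿB(L')` (`L ≤ L'`) is joined inside `B(L)` to `∂ⁱⁿB(L)`. -/
theorem arm_anti {ω : BondConfig (Site d)} (hω : ω ⊆ (zdGraph d).edgeSet) {a : Site d} {m L L' : ℕ}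
    (ha : a ∈ box d m) (hmL : m ≤ L) (hLL' : L ≤ L')
    (h : ∃ y ∈ innerBoundary (zdGraph d) (box d L'), ω ∈ openConnIn (↑(box d L') : Set (Site d)) a y) :
    ∃ z ∈ innerBoundary (zdGraph d) (box d L), ω ∈ openConnIn (↑(box d L) : Set (Site d)) a z := by
  rcases hLL'.eq_or_lt with rfl | hlt
  · exact h
  obtain ⟨y, hy, hay⟩ := h
  exact exists_mem_innerBoundary_openConnIn hω (box d L) (box_mono d hmL ha)
    (DCT16.notMem_box_of_mem_innerBoundary_box hlt hy) (StubInnerCellCount.reachable_of_mem_openConnIn hay)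

/-- **The pair event is antitone in the outer scale** (on lattice configurations): for `a, b ∈ B(m)` and
`m ≤ L ≤ L'`, two box-distinct crossers from `a`, `b` to `∂ⁱⁿB(L')` inside `B(L')` give two box-distinct
crossers to `∂ⁱⁿB(L)` inside `B(L)` (first exit for the arms; monotonicity of `{a ↔ b in ·}` for the
non-junction). -/
theorem pair_anti {ω : BondConfig (Site d)} (hω : ω ⊆ (zdGraph d).edgeSet) {a b : Site d}
    {m L L' : ℕ} (ha : a ∈ box d m) (hb : b ∈ box d m) (hmL : m ≤ L) (hLL' : L ≤ L')
    (h : (∃ y ∈ innerBoundary (zdGraph d) (box d L'), ω ∈ openConnIn (↑(box d L') : Set (Site d)) a y) ∧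
      (∃ y ∈ innerBoundary (zdGraph d) (box d L'), ω ∈ openConnIn (↑(box d L') : Set (Site d)) b y) ∧
      ω ∉ openConnIn (↑(box d L') : Set (Site d)) a b) :
    (∃ y ∈ innerBoundary (zdGraph d) (box d L), ω ∈ openConnIn (↑(box d L) : Set (Site d)) a y) ∧
      (∃ y ∈ innerBoundary (zdGraph d) (box d L), ω ∈ openConnIn (↑(box d L) : Set (Site d)) b y) ∧
      ω ∉ openConnIn (↑(box d L) : Set (Site d)) a b := by
  obtain ⟨h1, h2, h3⟩ := h
  refine ⟨arm_anti hω ha hmL hLL' h1, arm_anti hω hb hmL hLL' h2, fun hab => h3 ?_⟩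
  exact openConnIn_mono (Finset.coe_subset.2 (box_mono d hLL')) a b hab

/-- Measurability of `{x ↔ y in B(L)}` as a function of the configuration. -/
theorem measurable_mem_openConnIn_box (L : ℕ) (x y : Site d) :
    Measurable fun ω : BondConfig (Site d) => ω ∈ openConnIn (↑(box d L) : Set (Site d)) x y :=
  (PlanarDuality.determinedBy_openConnIn (box d L) x y).measurableSet_of_finset.mem

/-- The pair event at outer scale `L` is measurable. -/
theorem measurableSet_pair (a b : Site d) (L : ℕ) :
    MeasurableSet {ω : BondConfig (Site d) |
      (∃ y ∈ innerBoundary (zdGraph d) (box d L), ω ∈ openConnIn (↑(box d L) : Set (Site d)) a y) ∧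
      (∃ y ∈ innerBoundary (zdGraph d) (box d L), ω ∈ openConnIn (↑(box d L) : Set (Site d)) b y) ∧
      ω ∉ openConnIn (↑(box d L) : Set (Site d)) a b} := by
  refine measurableSet_setOf.2 (Measurable.and ?_ (Measurable.and ?_ (measurable_mem_openConnIn_box L a b).not))
  · exact Measurable.exists fun y => measurable_const.and (measurable_mem_openConnIn_box L a y)
  · exact Measurable.exists fun y => measurable_const.and (measurable_mem_openConnIn_box L b y)

/-! ### The pair event has vanishing probability as the outer scale grows -/

/-- **Two box-distinct crossers from a FIXED pair of points die out.** For every `d`, `p`, `m` and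
`a, b ∈ B(m)`: `P_p(a ↔ ∂ⁱⁿB(L) in B(L), b ↔ ∂ⁱⁿB(L) in B(L), a ↮ b in B(L)) → 0` as `L → ∞`
(continuity from above along the running intersection, which a.s. equals the event by `pair_anti`,
down to the null event `measure_twoInfinite_eq_zero`). -/
theorem pair_tendsto_zero (d : ℕ) (p : unitInterval) {m : ℕ} {a b : Site d}
    (ha : a ∈ box d m) (hb : b ∈ box d m) :
    Tendsto (fun L : ℕ => (bondPercolation (zdGraph d) p).real
      {ω | (∃ y ∈ innerBoundary (zdGraph d) (box d L), ω ∈ openConnIn (↑(box d L) : Set (Site d)) a y) ∧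
        (∃ y ∈ innerBoundary (zdGraph d) (box d L), ω ∈ openConnIn (↑(box d L) : Set (Site d)) b y) ∧
        ω ∉ openConnIn (↑(box d L) : Set (Site d)) a b}) atTop (𝓝 0) := by
  set μ : Measure (BondConfig (Site d)) := bondPercolation (zdGraph d) p with hμ
  -- the pair event at outer scale `L`
  set E : ℕ → Set (BondConfig (Site d)) := fun L =>
    {ω | (∃ y ∈ innerBoundary (zdGraph d) (box d L), ω ∈ openConnIn (↑(box d L) : Set (Site d)) a y) ∧
      (∃ y ∈ innerBoundary (zdGraph d) (box d L), ω ∈ openConnIn (↑(box d L) : Set (Site d)) b y) ∧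
      ω ∉ openConnIn (↑(box d L) : Set (Site d)) a b} with hE
  -- the running intersection `s K = ⋂_{k ≤ K} E (m + k)`: measurable, antitone
  set s : ℕ → Set (BondConfig (Site d)) := fun K => ⋂ k ∈ {k : ℕ | k ≤ K}, E (m + k) with hs
  have hsm : ∀ K, MeasurableSet (s K) := fun K =>
    MeasurableSet.biInter (Set.to_countable _) fun k _ => measurableSet_pair a b (m + k)
  have hanti : Antitone s := by
    intro K K' hKK' ω hω
    exact Set.mem_iInter₂.2 fun k (hk : k ≤ K) =>
      Set.mem_iInter₂.1 hω k (show k ∈ {k : ℕ | k ≤ K'} from hk.trans hKK')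
  -- a.s. `E (m + K) ⊆ s K` (antitonicity on lattice configurations)
  have hEs : ∀ K, μ.real (E (m + K)) ≤ μ.real (s K) := by
    intro K
    refine ENNReal.toReal_mono (measure_ne_top _ _) (measure_mono_ae ?_)
    filter_upwards [ae_subset_edgeSet (zdGraph d) p] with ω hω hωE
    exact Set.mem_iInter₂.2 fun k (hk : k ≤ K) =>
      pair_anti hω ha hb (Nat.le_add_right m k) (Nat.add_le_add_left hk m) hωE
  -- the full intersection is the null event "two distinct infinite clusters at `a`, `b`"
  have hlim : μ (⋂ K, s K) = 0 := by
    refine measure_mono_null (fun ω hω => ?_) (measure_twoInfinite_eq_zero d p a b)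
    have hall : ∀ k, ω ∈ E (m + k) := fun k =>
      Set.mem_iInter₂.1 (Set.mem_iInter.1 hω k) k (show k ∈ {k' : ℕ | k' ≤ k} from le_refl k)
    exact ⟨percolatesAt_of_forall fun k => (hall k).1, percolatesAt_of_forall fun k => (hall k).2.1,
      not_reachable_of_forall fun k => (hall k).2.2⟩
  -- continuity from above
  have hcont : Tendsto (fun K => μ (s K)) atTop (𝓝 0) := by
    have h := tendsto_measure_iInter_atTop (μ := μ) (fun K => (hsm K).nullMeasurableSet) hanti
      ⟨0, measure_ne_top _ _⟩
    rwa [hlim] at h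
  have hcontR : Tendsto (fun K => μ.real (s K)) atTop (𝓝 0) := by
    have h := (ENNReal.tendsto_toReal ENNReal.zero_ne_top).comp hcont
    rw [ENNReal.toReal_zero] at h
    exact h
  -- re-index `L = m + K` and squeeze
  have hshift : Tendsto (fun L : ℕ => μ.real (s (L - m))) atTop (𝓝 0) :=
    hcontR.comp (tendsto_sub_atTop_nat m)
  refine tendsto_of_tendsto_of_tendsto_of_le_of_le' tendsto_const_nhds hshift
    (Eventually.of_forall fun L => measureReal_nonneg) ?_
  filter_upwards [eventually_ge_atTop m] with L hL
  have h := hEs (L - m)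
  rwa [Nat.add_sub_cancel' hL] at h

/-! ### The multi-crosser event at fixed inner scale -/

/-- **Qualitative multi-crosser decay at fixed inner scale (every `d`, every `p`).** For `r ≥ 1` and a
fixed inner radius `m`, the probability that `r+1` points of `B(m)` are each joined inside `B(L)` to
`∂ⁱⁿB(L)` and pairwise NOT joined inside `B(L)` tends to `0` as `L → ∞`: the first two representatives
form a pair event, so the probability is at most the finite sum over pairs `a, b ∈ B(m)` of
`pair_tendsto_zero`. Dimension-free, hence idle for the crux by `Negative.nonProliferation_false_without_dimThree`;
the registered stub `stub_threeCrosserDecay` is the `m`-uniform `o(k⁻²)` sharpening at `L = km`, `d = 3`. -/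
theorem multiCross_tendsto_zero_of_fixed_inner (d : ℕ) (p : unitInterval) (r m : ℕ) (hr : 1 ≤ r) :
    Tendsto (fun L : ℕ => (bondPercolation (zdGraph d) p).real
      {ω | ∃ x : Fin (r + 1) → Site d, (∀ i, x i ∈ box d m) ∧
        (∀ i, ∃ y ∈ innerBoundary (zdGraph d) (box d L),
          ω ∈ openConnIn (↑(box d L) : Set (Site d)) (x i) y) ∧
        ∀ i j, i ≠ j → ω ∉ openConnIn (↑(box d L) : Set (Site d)) (x i) (x j)}) atTop (𝓝 0) := by
  classical
  set μ : Measure (BondConfig (Site d)) := bondPercolation (zdGraph d) p with hμ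
  set E : Site d → Site d → ℕ → Set (BondConfig (Site d)) := fun a b L =>
    {ω | (∃ y ∈ innerBoundary (zdGraph d) (box d L), ω ∈ openConnIn (↑(box d L) : Set (Site d)) a y) ∧
      (∃ y ∈ innerBoundary (zdGraph d) (box d L), ω ∈ openConnIn (↑(box d L) : Set (Site d)) b y) ∧
      ω ∉ openConnIn (↑(box d L) : Set (Site d)) a b} with hE
  -- two distinct indices
  have h01 : (⟨0, by omega⟩ : Fin (r + 1)) ≠ ⟨1, by omega⟩ := by
    intro h; have := congrArg Fin.val h; simp at this
  -- inclusion in the union over pairs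
  have hincl : ∀ L, {ω : BondConfig (Site d) | ∃ x : Fin (r + 1) → Site d, (∀ i, x i ∈ box d m) ∧
        (∀ i, ∃ y ∈ innerBoundary (zdGraph d) (box d L),
          ω ∈ openConnIn (↑(box d L) : Set (Site d)) (x i) y) ∧
        ∀ i j, i ≠ j → ω ∉ openConnIn (↑(box d L) : Set (Site d)) (x i) (x j)} ⊆
      ⋃ q ∈ box d m ×ˢ box d m, E q.1 q.2 L := by
    rintro L ω ⟨x, hx, hconn, hdisj⟩
    have hq : (x ⟨0, by omega⟩, x ⟨1, by omega⟩) ∈ box d m ×ˢ box d m :=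
      Finset.mem_product.2 ⟨hx _, hx _⟩
    exact Set.mem_biUnion hq ⟨hconn _, hconn _, hdisj _ _ h01⟩
  -- the finite sum of the pair probabilities tends to `0`
  have hsum : Tendsto (fun L : ℕ => ∑ q ∈ box d m ×ˢ box d m, μ.real (E q.1 q.2 L)) atTop (𝓝 0) := by
    have h : Tendsto (fun L : ℕ => ∑ q ∈ box d m ×ˢ box d m, μ.real (E q.1 q.2 L)) atTop
        (𝓝 (∑ q ∈ box d m ×ˢ box d m, (0 : ℝ))) :=
      tendsto_finsetSum _ fun q hq => by
        obtain ⟨ha, hb⟩ := Finset.mem_product.1 hq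
        exact pair_tendsto_zero d p ha hb
    simpa using h
  refine tendsto_of_tendsto_of_tendsto_of_le_of_le tendsto_const_nhds hsum
    (fun L => measureReal_nonneg) fun L => ?_
  exact (measureReal_mono (hincl L) (measure_ne_top _ _)).trans (measureReal_biUnion_finset_le _ _)

end FixedInnerDecay

/-- **The stub's indexing: for a FIXED inner radius `m ≥ 1`, three box-distinct crossers of the
critical annulus `B(km) ∖ B(m)` of `ℤ³` have probability tending to `0` as the ratio `k → ∞`** —
the qualitative, non-uniform shadow of `stub_threeCrosserDecay` (which asks `k² · P ≤ η` for ALL large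
`m` at one `k`). Unconditional; every `d` and `p` would do (`FixedInnerDecay.multiCross_tendsto_zero_of_fixed_inner`). -/
theorem threeCrossers_tendsto_zero_of_fixed_inner :
    ∀ m : ℕ, 1 ≤ m → Tendsto (fun k : ℕ => (bondPercolation (zdGraph 3) (criticalProbI 3)).real
      {ω | ∃ x : Fin (2 + 1) → Site 3, (∀ i, x i ∈ box 3 m) ∧
        (∀ i, ∃ y ∈ innerBoundary (zdGraph 3) (box 3 (k * m)),
          ω ∈ openConnIn (↑(box 3 (k * m)) : Set (Site 3)) (x i) y) ∧
        ∀ i j, i ≠ j → ω ∉ openConnIn (↑(box 3 (k * m)) : Set (Site 3)) (x i) (x j)}) atTop (𝓝 0) := by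
  intro m hm
  have hkm : Tendsto (fun k : ℕ => k * m) atTop atTop :=
    tendsto_atTop_mono (fun k => Nat.le_mul_of_pos_right k hm) tendsto_id
  exact (FixedInnerDecay.multiCross_tendsto_zero_of_fixed_inner 3 (criticalProbI 3) 2 m (by norm_num)).comp hkm

/-- **`η`-form in the stub's quantifier pattern, with the order of `k` and `m` exchanged.** For every
`η > 0` and every fixed inner radius `m ≥ 1` there is a ratio `k₀` beyond which
`k ↦ P_{p_c(ℤ³)}(three box-distinct crossers of B(km) ∖ B(m))` stays below `η` — compare the stub
`∀ η, ∃ k, ∃ m₀, ∀ m ≥ m₀, k² · P ≤ η`: here `k₀` depends on `m` and there is no factor `k²`; both gaps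
are the `d = 3` content (above six dimensions this theorem still holds and the stub's analogue fails). -/
theorem threeCrossers_eventually_le :
    ∀ η : ℝ, 0 < η → ∀ m : ℕ, 1 ≤ m → ∃ k₀ : ℕ, ∀ k : ℕ, k₀ ≤ k →
      (bondPercolation (zdGraph 3) (criticalProbI 3)).real
        {ω | ∃ x : Fin (2 + 1) → Site 3, (∀ i, x i ∈ box 3 m) ∧
          (∀ i, ∃ y ∈ innerBoundary (zdGraph 3) (box 3 (k * m)),
            ω ∈ openConnIn (↑(box 3 (k * m)) : Set (Site 3)) (x i) y) ∧
          ∀ i j, i ≠ j → ω ∉ openConnIn (↑(box 3 (k * m)) : Set (Site 3)) (x i) (x j)} ≤ η := by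
  intro η hη m hm
  exact eventually_atTop.1 ((threeCrossers_tendsto_zero_of_fixed_inner m hm).eventually
    (eventually_le_nhds hη))

/-- **`ε`-form in general dimension.** For every `d`, `p`, `r ≥ 1`, fixed inner radius `m` and `η > 0`, the
`(r+1)`-crosser probability of `B(L) ∖ B(m)` is eventually (in the OUTER scale `L`) at most `η`. The crux's
own event `repEvent d M n` has inner radius `n` growing with the outer one, so this gives nothing at ratio
`2`: the order of quantifiers (`m` fixed, then `L → ∞`) is exactly what separates it from the stub. -/
theorem multiCross_eventually_le (d : ℕ) (p : unitInterval) (r m : ℕ) (hr : 1 ≤ r) {η : ℝ} (hη : 0 < η) :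
    ∀ᶠ L : ℕ in atTop, (bondPercolation (zdGraph d) p).real
      {ω | ∃ x : Fin (r + 1) → Site d, (∀ i, x i ∈ box d m) ∧
        (∀ i, ∃ y ∈ innerBoundary (zdGraph d) (box d L),
          ω ∈ openConnIn (↑(box d L) : Set (Site d)) (x i) y) ∧
        ∀ i j, i ≠ j → ω ∉ openConnIn (↑(box d L) : Set (Site d)) (x i) (x j)} ≤ η :=
  ((FixedInnerDecay.multiCross_tendsto_zero_of_fixed_inner d p r m hr).eventually
    (eventually_le_nhds hη))

end Summit.CriticalPhenomena.PercolationContinuityZ3.Theorems.NonProliferation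

end
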